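import Summits.QuantumFields.YangMills.Theorems.FluctuationComparisonRegPrIntLSupTailCoverUnionTwoRegime
import Summits.QuantumFields.YangMills.Theorems.FluctuationComparisonRegPrIntLSupTailModulus
import Literature.MathematicalPhysics.QuantumFieldTheory.Balaban1983to89.T3AveragedTailProfile
import HarnessLib

/-!
# `FluctuationComparisonRegPrIntLSupTailCoverUnionEventual` — THE EVENTUAL + FLOOR EDITION OF ✓N §4, AND THE ARITHMETIC THAT TURNS PRINT'S PER-PLAQUETTE CURRENCY
# `C·β^A·e^{−c·p(g)²}` (AND THE FAR REGIME'S `e^{−κβ}`) INTO A SMALLNESS PROFILE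
# (crux `UnitScaleTilt.FluctuationComparisonRegPrIntL`, stmt-QuantumFields-20520; companion of ✓N `…SupTailCoverUnionTotal`, ✓O `…SupTailCoverUnionTwoRegime`, ✓B `…SupTailModulus`,
# lit `T3AveragedTailProfile`; consumed by `…SupTailCoverUnionPrintedForm`)

Cell `ym3-torus` (YM ladder rung R3 = continuum SU(2) Yang–Mills on T³ — a RUNG, NOT the Clay problem: not d = 4, not infinite volume, not a mass gap);
width seat `ym3-torus-px20` (gen 11); helper `--supports stmt-QuantumFields-20520`.  THEOREMS ONLY (0 `def`, 0 `sorry`, default heartbeats).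

WHAT.  ✓N ∕ ✓O ∕ ✓P reduce TAILSUP₁∘ to per-(level, fine plaquette) inputs PLUS bookkeeping letters chosen after `F, γ`: a smallness profile `s ≥ 0`, super-polynomially small,
`≤ ½` for `J ≥ J₀` (EVENTUAL: at small `J` the plaquette count `#T_{J+1} ≍ L^{3m+3(J+1)}` defeats any union bound once `F.m` is large — px21 g13's flag, cell RULING №42;
✓N §4's own `∀ J, s J ≤ ½` clause is therefore vacuous uniformly in `F.m`), weights with level sums `≤ s J`, and a floor below `J₀`.  This file:
* §1 (pure real analysis) `pow_three_mul_exp_neg_le_div` (`x³e^{−ax} ≤ 24∕(a⁴x)`) · ★`farLevel_le_geometric` — the FAR term of ✓O∕✓P: `9·(8L^{3m}(L^i)³)·e^{−κ·β_i} ≤ (72·24·L^{3m}·γ⁴∕κ⁴)·(1∕2)^i`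
  («exponential in `β_i = γ⁻¹L^i` beats the volume», companion of lit `perHeight_bound`'s «Gaussian in `p(g_i)` beats the volume») · `geometricProfile_nonneg ∕ _superpoly ∕
  _eventually_le_half` — `A'·(1∕2)^{J+1}` is `≥ 0`, super-polynomially small (✓B), and `≤ ½` for `J ≥ J₀(A')` · ★★`levelSum_printed_le_geometric` — the plaquette-uniform weight
  `C·β_{J+1}^A·e^{−c·p(g_{J+1})²}` summed over `T_{J+1}` is `≤ A'·(1∕2)^{J+1}` (✓L `card_plaq_level_le` ∘ lit `perHeight_bound`; `0 < γ ≤ 1`, `0 < b₀`, `1 ≤ p₀`) · ★★`farLevelSum_le_geometric`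
  — `#T_{J+1}·e^{−β_{J+1}δ₀²∕4}·e^{cM·β_{J+1}} ≤ A'_far·(1∕2)^{J+1}` for `cM < δ₀²∕4`.
* §2 ★★★`condGoodOddsDepthOneInt_of_pinnedTotalFineInt_eventual` ∕ ★★★`windowOddsSupDepthOneInt_of_pinnedTotalFineInt_eventual` — ✓N §4 with `(∀ J, s J ≤ ½)` replaced by
  `(∀ J ≥ J₀, s J ≤ ½)`, a floor `q J > 0` and ✓O's FLOOR row at `J < J₀`; `τ J := if J < J₀ then max 0 (−log q J) else 2·s J` (✓O `le_exp_negLog_mul_of_floor`,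
  `superpoly_of_eventually_eq` by name).  LEAD w3-20520 g17's FINAL «successor item (1)»: the class-(2) edition becomes class (1).
HONEST SCOPE.  Arithmetic + measure bookkeeping; the pinned rows, the eventual smallness and the floor are the HYPOTHESIS; TAILSUP₁∘, MOD₁∘, FAR₁, LFR♯ᶜ∘, S2β, 20520,
`YM3TorusSU2` NOT proved; the Yang–Mills mass gap is NOT proved.
HYP-SAT (cell RULING №42).  §2's letters (`J₀, s, q, σ`) are bound AFTER `F, γ`: satisfiable on the literal T³ families at the true quantifier order modulo the analytic contents
(the per-plaquette rows — chart + convexity one level deep, no hand yet — and the per-level floor, cst-p1 g35's FLOOR₁∘(J) pen); the companion `…PrintedForm` discharges `J₀, s, σ`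
by §1 once the rows are in print's currency.
References: [Balaban1985UV3] (1)–(3) p. 256, (7) p. 257, (38)–(40) p. 266, (67)–(71) p. 273.
-/

noncomputable section

set_option autoImplicit false

open MeasureTheory ProbabilityTheory Filter Topology Set
open scoped ENNReal NNReal BigOperators
open Literature.MathematicalPhysics.QuantumFieldTheory.Balaban1983to89
open Literature.MathematicalPhysics.QuantumFieldTheory.Balaban1983to89.T3ContinuumYM3Torus
open Literature.MathematicalPhysics.QuantumFieldTheory.Balaban1983to89.T3NestedUnitLaws
open Literature.MathematicalPhysics.QuantumFieldTheory.Balaban1983to89.T3UnitLawDensityEML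
open Literature.MathematicalPhysics.QuantumFieldTheory.Balaban1983to89.T3UnitScaleTilt
open Literature.MathematicalPhysics.QuantumFieldTheory.Balaban1983to89.T3TiltDescent
open Literature.MathematicalPhysics.QuantumFieldTheory.Balaban1983to89.Missing
open Literature.MathematicalPhysics.QuantumFieldTheory.Balaban1983to89.T4AveragingDisintegration
open scoped Literature.MathematicalPhysics.QuantumFieldTheory.Balaban1983to89.T3OrbitAverage
open Literature.MathematicalPhysics.QuantumFieldTheory.Balaban1983to89.T3AveragedTailProfile (perHeight_bound)
open Summit.QuantumFields.YangMills.Theorems.FluctuationComparisonRegPrIntLWregGlue (heightDensityCan)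
open Summit.QuantumFields.YangMills.Theorems.FluctuationComparisonRegPrIntLSupTailModulus (tendsto_pow_mul_geometric superpoly_of_le_geometric)
open Summit.QuantumFields.YangMills.Theorems.FluctuationComparisonRegPrIntLSupTailCoverUnion (card_plaq_level_le)
open Summit.QuantumFields.YangMills.Theorems.FluctuationComparisonRegPrIntLSupTailCoverUnionTotal (condGoodOddsDepthOne_of_pinnedRowsFineTotal)
open Summit.QuantumFields.YangMills.Theorems.FluctuationComparisonRegPrIntLSupTailCoverUnionTwoRegime (le_exp_negLog_mul_of_floor superpoly_of_eventually_eq)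

namespace Summit.QuantumFields.YangMills.Theorems.FluctuationComparisonRegPrIntLSupTailCoverUnionEventual

/-! ## §1 Arithmetic: the far level term is geometric; the geometric profile is a smallness profile -/

section Arith

/-- `x³·e^{−a·x} ≤ 24∕(a⁴·x)` for `x, a > 0` (`(ax)⁴∕4! ≤ e^{ax}`). [folklore] -/
theorem pow_three_mul_exp_neg_le_div {x a : ℝ} (hx : 0 < x) (ha : 0 < a) :
    x ^ 3 * Real.exp (-(a * x)) ≤ 24 / (a ^ 4 * x) := by
  have h := Real.pow_div_factorial_le_exp (a * x) (by positivity) 4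
  have h4 : ((Nat.factorial 4 : ℕ) : ℝ) = 24 := by norm_num [Nat.factorial]
  rw [h4] at h
  have hax : 0 < a * x := by positivity
  have h1 : (Real.exp (a * x))⁻¹ ≤ 24 / (a * x) ^ 4 := by
    calc (Real.exp (a * x))⁻¹ ≤ ((a * x) ^ 4 / 24)⁻¹ := inv_anti₀ (by positivity) h
      _ = 24 / (a * x) ^ 4 := by rw [inv_div]
  rw [Real.exp_neg]
  calc x ^ 3 * (Real.exp (a * x))⁻¹ ≤ x ^ 3 * (24 / (a * x) ^ 4) := by gcongr
    _ = 24 / (a ^ 4 * x) := by field_simp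

/-- ★ **THE FAR LEVEL TERM IS GEOMETRIC** («exponential in `β` beats the volume»): at distance `i` from the unit scale, `β_i = (γL^{−i})⁻¹ = γ⁻¹L^i`, and for `κ > 0`
`9·(8L^{3m}(L^i)³)·e^{−κ·β_i} ≤ (72·24·L^{3m}·γ⁴∕κ⁴)·(1∕2)^i` (`(L^i)³e^{−(κ∕γ)L^i} ≤ 24γ⁴∕(κ⁴L^i)` and `L ≥ 2`).  Companion of lit `T3AveragedTailProfile.perHeight_bound`.
[cite: Balaban1985UV3, (1)-(3) p.256 and (67)-(71) p.273] -/
theorem farLevel_le_geometric (F : T3Family) {γ : ℝ} (hγ : 0 < γ) {κ : ℝ} (hκ : 0 < κ) (i : ℕ) :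
    (9 * (8 * (F.L : ℝ) ^ (3 * F.m) * ((F.L : ℝ) ^ i) ^ 3)) * Real.exp (-(κ * (F.scheme ℰp γ).β i)) ≤
      (72 * 24 * (F.L : ℝ) ^ (3 * F.m) * γ ^ 4 / κ ^ 4) * ((1 : ℝ) / 2) ^ i := by
  have hL2 : (2 : ℝ) ≤ F.L := by exact_mod_cast F.hL.2
  have hL0 : (0 : ℝ) < F.L := by linarith
  set X : ℝ := (F.L : ℝ) ^ i with hX
  have hX0 : 0 < X := pow_pos hL0 i
  have hβ : (F.scheme ℰp γ).β i = X / γ := by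
    show (γ * ((F.L : ℝ)⁻¹) ^ i)⁻¹ = X / γ
    rw [inv_pow, mul_inv, inv_inv, ← hX, div_eq_inv_mul]
  -- `X³ e^{−(κ/γ) X} ≤ 24 γ⁴ ∕ (κ⁴ X)`
  have hmain : X ^ 3 * Real.exp (-(κ * (F.scheme ℰp γ).β i)) ≤ 24 * γ ^ 4 / κ ^ 4 * X⁻¹ := by
    rw [hβ, show κ * (X / γ) = κ / γ * X by ring]
    refine (pow_three_mul_exp_neg_le_div hX0 (div_pos hκ hγ)).trans (le_of_eq ?_)
    field_simp
  -- `X⁻¹ ≤ (1/2)^i`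
  have hXinv : X⁻¹ ≤ ((1 : ℝ) / 2) ^ i := by
    rw [hX, ← inv_pow, one_div]
    exact pow_le_pow_left₀ (inv_nonneg.mpr hL0.le) ((inv_le_inv₀ hL0 two_pos).mpr hL2) i
  calc (9 * (8 * (F.L : ℝ) ^ (3 * F.m) * X ^ 3)) * Real.exp (-(κ * (F.scheme ℰp γ).β i))
      = 72 * (F.L : ℝ) ^ (3 * F.m) * (X ^ 3 * Real.exp (-(κ * (F.scheme ℰp γ).β i))) := by ring
    _ ≤ 72 * (F.L : ℝ) ^ (3 * F.m) * (24 * γ ^ 4 / κ ^ 4 * X⁻¹) := by gcongr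
    _ ≤ 72 * (F.L : ℝ) ^ (3 * F.m) * (24 * γ ^ 4 / κ ^ 4 * ((1 : ℝ) / 2) ^ i) := by gcongr
    _ = (72 * 24 * (F.L : ℝ) ^ (3 * F.m) * γ ^ 4 / κ ^ 4) * ((1 : ℝ) / 2) ^ i := by ring

/-- The geometric profile `A'·(1∕2)^{J+1}` is non-negative for `A' ≥ 0`. [folklore] -/
theorem geometricProfile_nonneg {A' : ℝ} (hA : 0 ≤ A') (J : ℕ) : 0 ≤ A' * ((1 : ℝ) / 2) ^ (J + 1) := by positivity

/-- The geometric profile `A'·(1∕2)^{J+1}` is super-polynomially small: `(J+1)^a·A'·(1∕2)^{J+1} → 0` for every `a` (✓B `superpoly_of_le_geometric`). [folklore] -/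
theorem geometricProfile_superpoly {A' : ℝ} (hA : 0 ≤ A') (a : ℕ) :
    Tendsto (fun J : ℕ => ((J : ℝ) + 1) ^ a * (A' * ((1 : ℝ) / 2) ^ (J + 1))) atTop (𝓝 0) := by
  refine superpoly_of_le_geometric (A' := A') (geometricProfile_nonneg hA) (fun J => ?_) a
  rw [pow_succ]
  nlinarith [pow_nonneg (show (0 : ℝ) ≤ 1 / 2 by norm_num) J]

/-- The geometric profile `A'·(1∕2)^{J+1}` is `≤ ½` for `J ≥ J₀(A')` — the EVENTUAL smallness (`J₀` depends on `A'`, hence on `F.m` through the plaquette count). [folklore] -/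
theorem geometricProfile_eventually_le_half (A' : ℝ) : ∃ J₀ : ℕ, ∀ J : ℕ, J₀ ≤ J → A' * ((1 : ℝ) / 2) ^ (J + 1) ≤ 1 / 2 := by
  have h := tendsto_pow_mul_geometric 0 A'
  simp only [pow_zero, one_mul] at h
  have hev : ∀ᶠ J : ℕ in atTop, A' * ((1 : ℝ) / 2) ^ J ≤ 1 := (h.eventually (eventually_le_nhds one_pos)).mono fun J hJ => hJ
  obtain ⟨J₀, hJ₀⟩ := hev.exists_forall_of_atTop
  refine ⟨J₀, fun J hJ => ?_⟩
  have := hJ₀ J hJ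
  rw [pow_succ]
  nlinarith [pow_nonneg (show (0 : ℝ) ≤ 1 / 2 by norm_num) J]

variable (F : T3Family) {γ b₀ p₀ : ℝ}

/-- ★★ **THE ONE-REGIME SMALLNESS ROW IN PRINT'S CURRENCY**: `0 < γ ≤ 1`, `0 < b₀`, `1 ≤ p₀`, `C ≥ 0`, `A : ℕ`, `c > 0`.  With the plaquette-uniform weight
`σ_J = C·β_{J+1}^A·e^{−c·p(g_{J+1})²}` (`g_i = √(γL^{−i})`, `p = pFun b₀ p₀`) the level sum over `T_{J+1}` is `≤ A'·(1∕2)^{J+1}` with lit `perHeight_bound`'s constant `A'`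
(✓L `card_plaq_level_le` for `#T_{J+1} ≤ 9·8L^{3m}(L^{J+1})³`). [cite: Balaban1985UV3, (7) p.257 and (71) p.273] -/
theorem levelSum_printed_le_geometric (hγ : 0 < γ) (hγ1 : γ ≤ 1) (hb₀ : 0 < b₀) (hp₀ : 1 ≤ p₀) {C : ℝ} (hC : 0 ≤ C) (A : ℕ) {c : ℝ} (hc : 0 < c) (J : ℕ) :
    (Fintype.card (Plaq (F.P (J + 1)) 0) : ℝ) *
        (C * (F.scheme ℰp γ).β (J + 1) ^ A * Real.exp (-(c * B10.pFun b₀ p₀ (Real.sqrt (γ * ((F.L : ℝ)⁻¹) ^ (J + 1))) ^ 2))) ≤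
      (72 * C * (F.L : ℝ) ^ (3 * F.m) * γ⁻¹ ^ A *
          Real.exp ((((3 : ℝ) + A) * Real.log F.L + Real.log 2) ^ 2 / (4 * (c * b₀ ^ 2 * Real.log F.L ^ 2 / 4)))) *
        ((1 : ℝ) / 2) ^ (J + 1) := by
  have hw : 0 ≤ C * (F.scheme ℰp γ).β (J + 1) ^ A * Real.exp (-(c * B10.pFun b₀ p₀ (Real.sqrt (γ * ((F.L : ℝ)⁻¹) ^ (J + 1))) ^ 2)) :=
    mul_nonneg (mul_nonneg hC (pow_nonneg (F.scheme_β_nonneg ℰp hγ.le (J + 1)) A)) (Real.exp_nonneg _)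
  exact (mul_le_mul_of_nonneg_right (card_plaq_level_le F (J + 1)) hw).trans (perHeight_bound F hγ hγ1 hb₀ hp₀ hC A hc (J + 1))

/-- ★★ **THE FAR SMALLNESS ROW**: `0 < γ`, `cM < δ₀²∕4`.  The far level term of ✓O∕✓P with the linear moment `M J = cM·β_{J+1}` is
`#T_{J+1}·e^{−β_{J+1}δ₀²∕4}·e^{cM·β_{J+1}} ≤ (72·24·L^{3m}·γ⁴∕κ⁴)·(1∕2)^{J+1}`, `κ = δ₀²∕4 − cM` (`farLevel_le_geometric` + ✓L `card_plaq_level_le`).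
[cite: Balaban1985UV3, (67)-(71) p.273] -/
theorem farLevelSum_le_geometric (hγ : 0 < γ) {δ₀ cM : ℝ} (hκ : cM < δ₀ ^ 2 / 4) (J : ℕ) :
    (Fintype.card (Plaq (F.P (J + 1)) 0) : ℝ) *
        (Real.exp (-((F.scheme ℰp γ).β (J + 1) * δ₀ ^ 2 / 4)) * Real.exp (cM * (F.scheme ℰp γ).β (J + 1))) ≤
      (72 * 24 * (F.L : ℝ) ^ (3 * F.m) * γ ^ 4 / (δ₀ ^ 2 / 4 - cM) ^ 4) * ((1 : ℝ) / 2) ^ (J + 1) := by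
  have hexp : Real.exp (-((F.scheme ℰp γ).β (J + 1) * δ₀ ^ 2 / 4)) * Real.exp (cM * (F.scheme ℰp γ).β (J + 1)) =
      Real.exp (-((δ₀ ^ 2 / 4 - cM) * (F.scheme ℰp γ).β (J + 1))) := by
    rw [← Real.exp_add]; ring_nf
  rw [hexp]
  exact (mul_le_mul_of_nonneg_right (card_plaq_level_le F (J + 1)) (Real.exp_nonneg _)).trans
    (farLevel_le_geometric F hγ (sub_pos.mpr hκ) (J + 1))

end Arith

/-! ## §2 The EVENTUAL + FLOOR edition of ✓N §4: ⟨PINNED-TOTAL₁∘, `s ≤ ½` for `J ≥ J₀`, FLOOR below `J₀`⟩ ⇒ ✓K's ⟨COND-ODDS₁∘⟩ ⇒ TAILSUP₁∘ verbatim -/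

section Eventual

/-- ★★★ **⟨PINNED-TOTAL₁∘ (EVENTUAL) + FLOOR⟩ ⇒ ✓K's ⟨COND-ODDS₁∘⟩ VERBATIM** — ✓N `condGoodOddsDepthOneInt_of_pinnedTotalFineInt` with its `(∀ J, s J ≤ ½)` clause (NOT satisfiable
uniformly in `F.m`, cell RULING №42 class (2)) replaced by `(∀ J ≥ J₀, s J ≤ ½)` for a threshold `J₀` chosen after `F`, a floor `q J > 0`, and ✓O's FLOOR row
`ofReal(q J)·Gibbs_{J+1}(D⁻¹B) ≤ Gibbs_{J+1}(D⁻¹B ∩ histGood)` at the finitely many `J < J₀`; rows `Gibbs_{J+1}(D⁻¹B ∩ {θBal_{J+1} ≤ dist1 U(∂p)}) ≤ ofReal(σ J p)·Gibbs_{J+1}(D⁻¹B)`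
(TOTAL mass), `Σ_p σ J p ≤ s J`, `s ≥ 0` super-polynomially small; `τ J := if J < J₀ then max 0 (−log q J) else 2·s J`.  The interior window lies inside the history's window
(lit `θBal_mul_le`, `c ≤ c₀ ≤ 1`, `γ ≤ 1` — `γ₁ ↦ min γ₁ 1`). [cite: Balaban1985UV3, (2) p.256, (7) p.257 and (38)-(40) p.266] -/
theorem condGoodOddsDepthOneInt_of_pinnedTotalFineInt_eventual
    (h : ∀ (L : ℕ), ∃ c₀ : ℝ, 0 < c₀ ∧ c₀ ≤ 1 ∧ ∀ (c : ℝ), 0 < c → c ≤ c₀ → ∃ pS : ℝ, ∀ (b₀ p₀ : ℝ), 0 < b₀ → pS ≤ p₀ → 0 < p₀ →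
      ∃ γ₁ : ℝ, 0 < γ₁ ∧ ∀ (F : T3Family) (γ : ℝ), F.L = L → 0 < γ → γ ≤ γ₁ →
        ∃ (J₀ : ℕ) (s q : ℕ → ℝ) (σ : (J : ℕ) → Plaq (F.P (J + 1)) 0 → ℝ), (∀ J, 0 ≤ s J) ∧ (∀ J, J₀ ≤ J → s J ≤ 1 / 2) ∧
          (∀ a : ℕ, Tendsto (fun J : ℕ => ((J : ℝ) + 1) ^ a * s J) atTop (𝓝 0)) ∧ (∀ J p, 0 ≤ σ J p) ∧
          (∀ J, ∑ p : Plaq (F.P (J + 1)) 0, σ J p ≤ s J) ∧ (∀ J, 0 < q J) ∧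
          (∀ (J : ℕ), J < J₀ → ∀ (B : Set (GaugeField (F.P J) 0 (Matrix.specialUnitaryGroup (Fin 2) ℂ))), MeasurableSet B →
            B ⊆ {U | PlaqSmall (θBal F.L γ (c * b₀) p₀ J) U} →
            ENNReal.ofReal (q J) * gibbsK F ℰp γ (J + 1) (descendTo F ℰp J (J + 1) (Nat.le_succ J) ⁻¹' B) ≤
              gibbsK F ℰp γ (J + 1) (descendTo F ℰp J (J + 1) (Nat.le_succ J) ⁻¹' B ∩ histGood F ℰp (θBal F.L γ b₀ p₀) (J + 1) J)) ∧
          ∀ (J : ℕ) (p : Plaq (F.P (J + 1)) 0) (B : Set (GaugeField (F.P J) 0 (Matrix.specialUnitaryGroup (Fin 2) ℂ))), MeasurableSet B →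
            B ⊆ {U | PlaqSmall (θBal F.L γ (c * b₀) p₀ J) U} →
            gibbsK F ℰp γ (J + 1) (descendTo F ℰp J (J + 1) (Nat.le_succ J) ⁻¹' B ∩
                {U | θBal F.L γ b₀ p₀ (J + 1) ≤ dist1 (GaugeField.plaqHol U p)}) ≤
              ENNReal.ofReal (σ J p) * gibbsK F ℰp γ (J + 1) (descendTo F ℰp J (J + 1) (Nat.le_succ J) ⁻¹' B)) :
    ∀ (L : ℕ), ∃ c₀ : ℝ, 0 < c₀ ∧ c₀ ≤ 1 ∧ ∀ (c : ℝ), 0 < c → c ≤ c₀ → ∃ pS : ℝ, ∀ (b₀ p₀ : ℝ), 0 < b₀ → pS ≤ p₀ → 0 < p₀ →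
      ∃ γ₁ : ℝ, 0 < γ₁ ∧ ∀ (F : T3Family) (γ : ℝ), F.L = L → 0 < γ → γ ≤ γ₁ →
        ∃ τ : ℕ → ℝ, (∀ J, 0 ≤ τ J) ∧ (∀ a : ℕ, Tendsto (fun J : ℕ => ((J : ℝ) + 1) ^ a * τ J) atTop (𝓝 0)) ∧
          ∀ (J : ℕ) (B : Set (GaugeField (F.P J) 0 (Matrix.specialUnitaryGroup (Fin 2) ℂ))), MeasurableSet B →
            B ⊆ {U | PlaqSmall (θBal F.L γ (c * b₀) p₀ J) U} →
            gibbsK F ℰp γ (J + 1) (descendTo F ℰp J (J + 1) (Nat.le_succ J) ⁻¹' B) ≤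
              ENNReal.ofReal (Real.exp (τ J)) *
                gibbsK F ℰp γ (J + 1) (descendTo F ℰp J (J + 1) (Nat.le_succ J) ⁻¹' B ∩ histGood F ℰp (θBal F.L γ b₀ p₀) (J + 1) J) := by
  intro L
  obtain ⟨c₀, hc₀, hc₀1, hc⟩ := h L
  refine ⟨c₀, hc₀, hc₀1, fun c hcpos hcle => ?_⟩
  obtain ⟨pS, hpS⟩ := hc c hcpos hcle
  refine ⟨pS, fun b₀ p₀ hb₀ hpS' hp₀ => ?_⟩
  obtain ⟨γ₁, hγ₁, hγ₁F⟩ := hpS b₀ p₀ hb₀ hpS' hp₀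
  refine ⟨min γ₁ 1, lt_min hγ₁ one_pos, fun F γ hFL hγ hγle => ?_⟩
  have hγ1 : γ ≤ 1 := le_trans hγle (min_le_right γ₁ 1)
  obtain ⟨J₀, s, q, σ, hs0, hshalf, hsa, hσ0, hσs, hq, hfloor, hrows⟩ := hγ₁F F γ hFL hγ (le_trans hγle (min_le_left γ₁ 1))
  refine ⟨fun J => if J < J₀ then max 0 (-Real.log (q J)) else 2 * s J, fun J => ?_, ?_, ?_⟩
  · dsimp only
    by_cases hJ : J < J₀
    · rw [if_pos hJ]; exact le_max_left _ _
    · rw [if_neg hJ]; linarith [hs0 J]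
  · refine superpoly_of_eventually_eq J₀ (fun J hJ => ?_) hsa
    rw [if_neg (not_lt.mpr hJ)]
  intro J B hB hBW
  dsimp only
  by_cases hJ : J < J₀
  · -- the finitely many low levels: the floor
    rw [if_pos hJ]
    exact le_exp_negLog_mul_of_floor (hq J) (hfloor J hJ B hB hBW)
  rw [if_neg hJ]
  -- the interior window lies inside the history's level-`J` window (`c ≤ c₀ ≤ 1`, `γ ≤ 1`)
  have hBJ : B ⊆ {U : GaugeField (F.P J) 0 (Matrix.specialUnitaryGroup (Fin 2) ℂ) | PlaqSmall (θBal F.L γ b₀ p₀ J) U} := fun U hU =>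
    T3PrintedMinimiserExistence.plaqSmall_of_le
      (T3InteriorExcision.θBal_mul_le (le_of_lt F.hL.2) hγ hγ1 hb₀ (hcle.trans hc₀1) p₀ J) (hBW hU)
  have hmain := condGoodOddsDepthOne_of_pinnedRowsFineTotal F hγ.le (θBal F.L γ b₀ p₀) J (σ J) (hσ0 J)
    ((hσs J).trans (hshalf J (not_lt.mp hJ))) hBJ (fun p => hrows J p B hB hBW)
  refine hmain.trans (mul_le_mul' (ENNReal.ofReal_le_ofReal (Real.exp_le_exp.mpr ?_)) le_rfl)
  linarith [hσs J]

/-- ★★★ **⟨PINNED-TOTAL₁∘ (EVENTUAL) + FLOOR⟩ ⇒ TAILSUP₁∘** (LINE g21-2 v1.4's interior row `RunPairOrgan.OneLoop.WindowOddsSupDepthOneIntCan`, text verbatim): §2 then ✓K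
`windowOddsSupDepthOneIntCan_of_condGoodOddsDepthOneInt`.  HONEST SCOPE: the total-mass pinned rows, the eventual smallness and the floor are the HYPOTHESIS; nothing
upstream is proved. [cite: Balaban1985UV3, (2) p.256, (7) p.257, (38)-(40) p.266 and (71) p.273] -/
theorem windowOddsSupDepthOneInt_of_pinnedTotalFineInt_eventual
    (h : ∀ (L : ℕ), ∃ c₀ : ℝ, 0 < c₀ ∧ c₀ ≤ 1 ∧ ∀ (c : ℝ), 0 < c → c ≤ c₀ → ∃ pS : ℝ, ∀ (b₀ p₀ : ℝ), 0 < b₀ → pS ≤ p₀ → 0 < p₀ →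
      ∃ γ₁ : ℝ, 0 < γ₁ ∧ ∀ (F : T3Family) (γ : ℝ), F.L = L → 0 < γ → γ ≤ γ₁ →
        ∃ (J₀ : ℕ) (s q : ℕ → ℝ) (σ : (J : ℕ) → Plaq (F.P (J + 1)) 0 → ℝ), (∀ J, 0 ≤ s J) ∧ (∀ J, J₀ ≤ J → s J ≤ 1 / 2) ∧
          (∀ a : ℕ, Tendsto (fun J : ℕ => ((J : ℝ) + 1) ^ a * s J) atTop (𝓝 0)) ∧ (∀ J p, 0 ≤ σ J p) ∧
          (∀ J, ∑ p : Plaq (F.P (J + 1)) 0, σ J p ≤ s J) ∧ (∀ J, 0 < q J) ∧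
          (∀ (J : ℕ), J < J₀ → ∀ (B : Set (GaugeField (F.P J) 0 (Matrix.specialUnitaryGroup (Fin 2) ℂ))), MeasurableSet B →
            B ⊆ {U | PlaqSmall (θBal F.L γ (c * b₀) p₀ J) U} →
            ENNReal.ofReal (q J) * gibbsK F ℰp γ (J + 1) (descendTo F ℰp J (J + 1) (Nat.le_succ J) ⁻¹' B) ≤
              gibbsK F ℰp γ (J + 1) (descendTo F ℰp J (J + 1) (Nat.le_succ J) ⁻¹' B ∩ histGood F ℰp (θBal F.L γ b₀ p₀) (J + 1) J)) ∧
          ∀ (J : ℕ) (p : Plaq (F.P (J + 1)) 0) (B : Set (GaugeField (F.P J) 0 (Matrix.specialUnitaryGroup (Fin 2) ℂ))), MeasurableSet B →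
            B ⊆ {U | PlaqSmall (θBal F.L γ (c * b₀) p₀ J) U} →
            gibbsK F ℰp γ (J + 1) (descendTo F ℰp J (J + 1) (Nat.le_succ J) ⁻¹' B ∩
                {U | θBal F.L γ b₀ p₀ (J + 1) ≤ dist1 (GaugeField.plaqHol U p)}) ≤
              ENNReal.ofReal (σ J p) * gibbsK F ℰp γ (J + 1) (descendTo F ℰp J (J + 1) (Nat.le_succ J) ⁻¹' B)) :
    ∀ (L : ℕ), ∃ c₀ : ℝ, 0 < c₀ ∧ c₀ ≤ 1 ∧ ∀ (c : ℝ), 0 < c → c ≤ c₀ → ∃ pS : ℝ, ∀ (b₀ p₀ : ℝ), 0 < b₀ → pS ≤ p₀ → 0 < p₀ →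
    ∃ γ₁ : ℝ, 0 < γ₁ ∧ ∀ (F : T3Family) (γ : ℝ), F.L = L → 0 < γ → γ ≤ γ₁ →
      ∃ τ : ℕ → ℝ, (∀ J, 0 ≤ τ J) ∧ (∀ a : ℕ, Tendsto (fun J : ℕ => ((J : ℝ) + 1) ^ a * τ J) atTop (𝓝 0)) ∧
        ∀ (ν : ℕ → (j : ℕ) → Measure (GaugeField (F.P j) 0 (Matrix.specialUnitaryGroup (Fin 2) ℂ))),
          (∀ K, ν K K = T4GenFunBounds.gibbsMeasure (F.P K) ((F.scheme ℰp γ).β K)) →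
          (∀ K j, j < K → ν K j = Measure.map (descend F ℰp j) (ν K (j + 1))) →
          ∀ (J : ℕ) (ρ : GaugeField (F.P J) 0 (Matrix.specialUnitaryGroup (Fin 2) ℂ) → ℝ),
            (∀ U, PlaqSmall (θBal F.L γ (c * b₀) p₀ J) U → 0 < ρ U) →
            ν (J + 1) J = (fieldMeasure _ _ _).withDensity (fun U => ENNReal.ofReal (ρ U)) →
            ContinuousOn ρ {U | PlaqSmall (θBal F.L γ (c * b₀) p₀ J) U} →
            (∀ U : GaugeField (F.P J) 0 (Matrix.specialUnitaryGroup (Fin 2) ℂ), PlaqSmall (θBal F.L γ (c * b₀) p₀ J) U →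
                0 < heightDensityCan F γ (Nat.le_succ J) (histGood F ℰp (θBal F.L γ b₀ p₀) (J + 1) J) U) →
            ∃ a₀ : ℝ, ∀ U : GaugeField (F.P J) 0 (Matrix.specialUnitaryGroup (Fin 2) ℂ), PlaqSmall (θBal F.L γ (c * b₀) p₀ J) U →
              0 ≤ Real.log (ρ U) - a₀ - Real.log (heightDensityCan F γ (Nat.le_succ J) (histGood F ℰp (θBal F.L γ b₀ p₀) (J + 1) J) U) ∧
              Real.log (ρ U) - a₀ - Real.log (heightDensityCan F γ (Nat.le_succ J) (histGood F ℰp (θBal F.L γ b₀ p₀) (J + 1) J) U) ≤ τ J :=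
  FluctuationComparisonRegPrIntLSupTailReductionInt.windowOddsSupDepthOneIntCan_of_condGoodOddsDepthOneInt
    (condGoodOddsDepthOneInt_of_pinnedTotalFineInt_eventual h)

end Eventual

end Summit.QuantumFields.YangMills.Theorems.FluctuationComparisonRegPrIntLSupTailCoverUnionEventual

end
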